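import Summits.ResolutionOfSingularities.ResolutionOfSingularities.Theses.ShadowGame
import Summits.ResolutionOfSingularities.ResolutionOfSingularities.Theses.FoliationDescent
import Summits.ResolutionOfSingularities.ResolutionOfSingularities.Theorems.ValuativeTorsorToLurelFfiniteGenerators
import HarnessLib

/-!
# Crux `TorsorToLurelPerfect` (stmt-ResolutionOfSingularities-16162) — birth skeleton (BC3), line `birth`

Route `ResolutionOfSingularities/FoliationDescent` (crux #5, rank 5, difficulty L). The item is
SHARED: the same decl, byte-identical, is a crux of routes ShadowGame (the item's primary decl,
`Theses.ShadowGame.TorsorToLurelPerfect`, which `ledger skeleton check` resolves to) /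
FrobeniusClosing / WildCones / JacobianBudget; the five constants are definitionally equal
(`torsorToLurelPerfect_foliationDescent_iff_shadowGame` below is `Iff.rfl`), so this file
concludes BOTH the payload route's decl (`TorsorToLurelPerfect_of`,
`TorsorToLurelPerfect_proof_foliationDescent`) and the primary decl
(`TorsorToLurelPerfect_of_shadowGame`, `TorsorToLurelPerfect_proof`) by the same term; the other
three follow verbatim (not imported here only to keep the import cone small).

`TorsorToLurelPerfect` = "for every prime `p`: local uniformization of `α_p`-torsors `t ^ p = a`
over bases regular at the centre, over PERFECT ground fields of characteristic `p`
(`PerfectTorsorLU p` below, the body of the target `TorsorLUPerfect` at `p`) implies RELATIVE local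
uniformization for every finitely generated `K/k` with `k` PERFECT of characteristic `p`
(`PerfectLUrel p` below)" — Temkin 2013 (J. Algebra 373 = arXiv:0804.1554), Rem. 1.3.5 (i)–(ii)
specialised to `[k : k^p] = 1`.

## The cut (two named stubs; `TorsorToLurelPerfect_of` proved)

The crux is an implication whose paper proof has exactly two non-bookkeeping ingredients, and the
cut follows them (it is the cut that CLOSED the all-`k` sibling `Valuative.TorsorToLurel`,
stmt-10968, whose registered stubs `stub_ttlPerfectDescent` / `stub_ttlTowerAbsorb` landed as
`Theorems/ValuativeTorsorToLurelPerfectDescent.lean` / `…TowerAbsorb.lean` — but both of those USE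
the torsor hypothesis over ALL ground fields of characteristic `p`, which this crux does not
have: here the hypothesis carries `[PerfectField k]`):

* `stub_perfectFrobeniusChart` — **Temkin's inseparable local uniformization, Frobenius-pushed,
  over a perfect ground field (the load-bearing stub; TRUE IN PRINT, in tree modulo ONE leaf).**
  `k` perfect of characteristic `p`, `K/k` finitely generated, `O ⊇ k` a valuation ring of `K`,
  `R ⊆ O` a finitely generated `k`-subalgebra ⇒ there are `m : ℕ` and a finitely generated
  `k`-subalgebra `A₀ ⊆ O`, REGULAR at the centre `𝔪_O ∩ A₀`, with `R ^ {p^m} ⊆ A₀` and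
  `K ^ {p^m} ⊆ k(A₀)`. Paper proof: Temkin 2013 Thm. 1.3.2 (relative form = Literature fact
  `Temkin2013Relative`, reduced in tree to the single leaf `Temkin2013RelativeCurveSmoothFibre`)
  gives a finite purely inseparable `L/K` and a chart `N ⊆ O'` of `L`, finitely generated over
  `k`, `Frac N = L`, regular at the centre, containing an affine model `R' ⊇ R`; with `pᵐ ≥` the
  exponent of `L/K`, Frobenius `ρ = F^m : L → K` maps `N` isomorphically onto `A₀ := ρ(N) ⊆ O`
  (in tree: `comap_iterateFrobenius_eq`, `exists_subalgebra_frobeniusBaseField`,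
  `isRegularLocalRing_centre_map_iterateFrobenius`, `pow_mem_adjoin_of_isFractionRing`,
  `pow_mem_of_algebraMap_mem` of `Theorems/ValuativeTorsorToLurelFfiniteFrobenius.lean`), a
  finitely generated algebra over `F = k^{pᵐ} ⊆ K`; BECAUSE `k` IS PERFECT, `F = k` (Frobenius of
  `k` is onto), so `A₀` is a `k`-subalgebra and `k(A₀) = F(A₀) ⊇ K^{pᵐ}`. Why it might fail /
  what is open: nothing beyond the crux's own named risk — the in-tree proof is conditional on
  `Temkin2013RelativeCurveSmoothFibre` (Temkin 2013 Thm. 3.3.1 for `k`-smooth generic fibres);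
  unconditionally the stub is Temkin's theorem itself over perfect fields. Size: L (S modulo
  `Temkin2013Relative`: steps 0–2 of `torsorToLurelFfinite_of_temkin2013Relative` verbatim plus
  the identification `F = k`).
* `stub_perfectTowerAbsorb` — **the `p`-radical tower with the PERFECT torsor hypothesis, and
  absorption (TRUE; size M).** Given `PerfectTorsorLU p`, `k` perfect, a chart `A₀ ⊆ O` over `k`
  (finitely generated, regular at the centre), `R ^ {p^m} ⊆ A₀`, and a finite set `G ⊆ O` of
  field generators of `K/k` with `g ^ {p^m} ∈ k(A₀)`: there is a chart `A ⊇ R` with `Frac A = K`.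
  Paper proof (Temkin Rem. 1.3.5 (ii) over `k` itself): adjoin the `g ∈ G` one `p`-th root at a
  time — each step ONE application of the torsor hypothesis to the intermediate field
  `E = k(A_i, t) ≤ K` OVER THE SAME GROUND FIELD `k` (so perfectness of the ground field is
  preserved along the tower: this is exactly why the perfect-only hypothesis suffices), moving
  regularity at the centre in and out of `E` (`isRegularLocalRing_centre_map_iff`, in tree) —
  to reach `A₁ ⊇ A₀` with `k(A₁) = K`; then `A := k[A₁, R]` has all `pᵐ`-th powers in `A₁`, hence
  is regular at the centre by normality (`isRegularLocalRing_centre_of_pow_mem`, in tree). In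
  tree this is `torsor_step` / `torsor_root(s)` / `stub_ttlTowerAbsorb` re-run with
  `[PerfectField F]` added to the torsor hypothesis AND to the ground field (their proofs never
  change the ground field). Why it might fail: only a typing slip (an instance the subfield-as-type
  `E` does not synthesize); mathematically it is the landed all-`k` argument. Size: M.
* The assembly `TorsorToLurelPerfect_of : Sig.stub_perfectFrobeniusChart →
  Sig.stub_perfectTowerAbsorb → TorsorToLurelPerfect` is PROVED (no `sorry` in its term): unfold
  the crux; stub 1 gives `(m, A₀)`; `exists_finset_generators_mem` (in tree, sorry-free) gives
  finitely many generators of `K/k` inside `O`; stub 2 concludes. `TorsorToLurelPerfect_proof :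
  TorsorToLurelPerfect` is the same with the two `stub_*` plugged in.

Neither stub is the crux or the summit in disguise: stub 1 has NO torsor hypothesis and does not
reach `Frac A = K` (it stops `pᵐ` below `K`); stub 2 has no way to produce its regular chart `A₀`
(that is Temkin's theorem). BC3 probes `stub → TorsorToLurelPerfect`, `stub → ResolutionOfSingularities`
by `exact?` / `aesop` / `intro; exact?` / `simpa [defs]` fail 16/16, and the combined
`first | exact? | simpa [..] | (unfold ..; simpa) | aesop` form fails 4/4 (audit in `Lines/birth.md`).

Disproof used: none on file (`ledger crux ls stmt-ResolutionOfSingularities-16162`: no workfiles,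
no `Disproof.lean`, no Negative lemmas, 2026-08-17); `ledger negatives --problem
ResolutionOfSingularities` lists one refuted statement (DefectlessFrames 19085, hypersurface
frames with `f = 0` allowed) — unrelated to charts/towers, no stub is an instance of it.
Barrier `Literature.Barriers.ResolutionOfSingularities.InseparableBaseChange` (regular ≠
geometrically regular): not touched — no base change of the ground field occurs anywhere (the
ground field is `k` throughout; Frobenius transport is an isomorphism of rings `N ≅ ρ(N)`).
-/

noncomputable section

-- single-problem summit: the doubled namespace component `ResolutionOfSingularities` is forced
set_option linter.dupNamespace false

open IsLocalRing
namespace Summit.ResolutionOfSingularities.ResolutionOfSingularities.Cruxes.TorsorToLurelPerfect.Lines.Birth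

/-! ## The two halves of the crux, by name -/

/-- **The crux hypothesis at the prime `p`** — local uniformization of `α_p`-torsors `t ^ p = a`
over bases regular at the centre, over PERFECT ground fields of characteristic `p` (verbatim the
body of the route target `TorsorLUPerfect` at `p`, i.e. the antecedent of `TorsorToLurelPerfect`).
[cite: Temkin2013, Rem. 1.3.5 (ii)] -/
def PerfectTorsorLU (p : ℕ) : Prop :=
  ∀ (k K : Type) [Field k] [CharP k p] [PerfectField k] [Field K] [Algebra k K]
    (O : ValuationSubring K) (A₀ : Subalgebra k K) (h₀ : A₀.toSubring ≤ O.toSubring) (t : K),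
    A₀.FG → t ^ p ∈ A₀ → IsFractionRing (Algebra.adjoin k (insert t (A₀ : Set K))) K →
    IsRegularLocalRing (Localization.AtPrime
      (Ideal.comap (Subring.inclusion h₀) (maximalIdeal O))) →
    ∃ (A : Subalgebra k K) (h : A.toSubring ≤ O.toSubring), A₀ ≤ A ∧ t ∈ A ∧ A.FG ∧
      IsFractionRing A K ∧
      IsRegularLocalRing (Localization.AtPrime (Ideal.comap (Subring.inclusion h) (maximalIdeal O)))

/-- **The crux conclusion at the prime `p`** — relative local uniformization over PERFECT ground
fields of characteristic `p`: every finitely generated `R ⊆ O` is dominated by a finitely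
generated `A ⊆ O` with `Frac A = K`, regular at the centre (verbatim the consequent of
`TorsorToLurelPerfect`, = the antecedent of `PatchingRelPerfect` at `p`).
[cite: Temkin2013, Thm. 1.3.2 and Rem. 1.3.5] -/
def PerfectLUrel (p : ℕ) : Prop :=
  ∀ (k K : Type) [Field k] [CharP k p] [PerfectField k] [Field K] [Algebra k K],
    (⊤ : IntermediateField k K).FG → ∀ O : ValuationSubring K, (∀ c : k, algebraMap k K c ∈ O) →
    ∀ R : Subalgebra k K, R.FG → R.toSubring ≤ O.toSubring →
    ∃ (A : Subalgebra k K) (h : A.toSubring ≤ O.toSubring), R ≤ A ∧ A.FG ∧ IsFractionRing A K ∧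
      IsRegularLocalRing (Localization.AtPrime (Ideal.comap (Subring.inclusion h) (maximalIdeal O)))

/-- Sanity (definitional): the crux is, prime by prime, `PerfectTorsorLU p → PerfectLUrel p`.
[folklore] -/
theorem torsorToLurelPerfect_iff :
    Theses.FoliationDescent.TorsorToLurelPerfect ↔
      ∀ p : ℕ, p.Prime → PerfectTorsorLU p → PerfectLUrel p :=
  Iff.rfl

/-- Sanity (definitional): the payload route's decl and the item's primary decl (route
ShadowGame) are the same proposition — the shared item stmt-16162 is ONE obligation. [folklore] -/
theorem torsorToLurelPerfect_foliationDescent_iff_shadowGame :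
    Theses.FoliationDescent.TorsorToLurelPerfect ↔ Theses.ShadowGame.TorsorToLurelPerfect :=
  Iff.rfl

/-! ## The two stub STATEMENTS by name (`Sig.stub_<name>`; the composition
`TorsorToLurelPerfect_of` takes exactly these as hypotheses) -/

/-- Statement of `stub_perfectFrobeniusChart`: **Temkin's inseparable local uniformization in
Frobenius-pushed form over a PERFECT ground field** — for `k` perfect of characteristic `p`,
`K/k` finitely generated, `O ⊇ k` a valuation ring of `K` and `R ⊆ O` finitely generated, there
are `m` and a finitely generated `k`-subalgebra `A₀ ⊆ O`, regular at the centre, with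
`R ^ {p^m} ⊆ A₀` and `K ^ {p^m} ⊆ k(A₀)`. (No torsor hypothesis; does not reach `Frac A₀ = K`.)
[cite: Temkin2013, Thm. 1.3.2 and Rem. 1.3.5 (i)] -/
def Sig.stub_perfectFrobeniusChart : Prop :=
  ∀ p : ℕ, p.Prime → ∀ (k K : Type) [Field k] [CharP k p] [PerfectField k] [Field K] [Algebra k K],
    (⊤ : IntermediateField k K).FG → ∀ O : ValuationSubring K, (∀ c : k, algebraMap k K c ∈ O) →
    ∀ R : Subalgebra k K, R.FG → R.toSubring ≤ O.toSubring →
    ∃ (m : ℕ) (A₀ : Subalgebra k K) (h₀ : A₀.toSubring ≤ O.toSubring), A₀.FG ∧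
      (∀ r ∈ R, r ^ p ^ m ∈ A₀) ∧
      (∀ x : K, x ^ p ^ m ∈ IntermediateField.adjoin k (A₀ : Set K)) ∧
      IsRegularLocalRing (Localization.AtPrime
        (Ideal.comap (Subring.inclusion h₀) (maximalIdeal O)))

/-- Statement of `stub_perfectTowerAbsorb`: **tower and absorb with the PERFECT torsor
hypothesis** — given `PerfectTorsorLU p`, `k` perfect, a chart `A₀ ⊆ O` over `k` (finitely
generated, regular at the centre) with `R ^ {p^m} ⊆ A₀` and `g ^ {p^m} ∈ k(A₀)` for every `g` in
a finite set `G ⊆ O` of field generators of `K/k`, there is a chart `A ⊇ R` with `Frac A = K`.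
(Each tower step applies the torsor hypothesis over the SAME perfect ground field `k` to an
intermediate field `k(A_i, t) ≤ K`; absorption by normality of the regular centre.)
[cite: Temkin2013, Rem. 1.3.5 (ii)] -/
def Sig.stub_perfectTowerAbsorb : Prop :=
  ∀ p : ℕ, p.Prime → PerfectTorsorLU p →
    ∀ (k K : Type) [Field k] [CharP k p] [PerfectField k] [Field K] [Algebra k K]
      (O : ValuationSubring K) (R : Subalgebra k K), R.FG → R.toSubring ≤ O.toSubring →
      ∀ G : Finset K, (∀ g ∈ G, g ∈ O) → IntermediateField.adjoin k (G : Set K) = ⊤ →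
      ∀ (m : ℕ) (A₀ : Subalgebra k K) (h₀ : A₀.toSubring ≤ O.toSubring), A₀.FG →
        IsRegularLocalRing (Localization.AtPrime
          (Ideal.comap (Subring.inclusion h₀) (maximalIdeal O))) →
        (∀ r ∈ R, r ^ p ^ m ∈ A₀) →
        (∀ g ∈ G, g ^ p ^ m ∈ IntermediateField.adjoin k (A₀ : Set K)) →
        ∃ (A : Subalgebra k K) (h : A.toSubring ≤ O.toSubring), R ≤ A ∧ A.FG ∧
          IsFractionRing A K ∧
          IsRegularLocalRing (Localization.AtPrime
            (Ideal.comap (Subring.inclusion h) (maximalIdeal O)))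

/-! ## The stubs -/

/-- **STUB (load-bearing; Temkin's theorem over perfect fields, in tree modulo the leaf
`Temkin2013RelativeCurveSmoothFibre`).** Frobenius-pushed inseparable local uniformization over a
perfect ground field: see the module docstring (Thm. 1.3.2 ⇒ chart `N` of a finite purely
inseparable `L ⊇ K`; `A₀ := F^m(N) ⊆ K`, a `k`-subalgebra because `k^{p^m} = k`).
[cite: Temkin2013, Thm. 1.3.2 and Rem. 1.3.5 (i)] -/
theorem stub_perfectFrobeniusChart : Sig.stub_perfectFrobeniusChart := by
  sorry

/-- **STUB (true, size M).** The `p`-radical tower climbed with the perfect torsor hypothesis,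
then absorption of `R` by normality of the regular centre: see the module docstring (the in-tree
`torsor_step` / `torsor_roots` / `stub_ttlTowerAbsorb` re-run with `[PerfectField]` on the torsor
hypothesis and on the ground field, which their proofs never change).
[cite: Temkin2013, Rem. 1.3.5 (ii)] -/
theorem stub_perfectTowerAbsorb : Sig.stub_perfectTowerAbsorb := by
  sorry

/-! ## The composition (kernel-checked; no `sorry` in its own term) -/

/-- **`TorsorToLurelPerfect` from the two stub statements** — the assembly, PROVED: at a prime
`p`, with the perfect torsor hypothesis `hT` and data `(k, K, O, R)` over a perfect `k`, stub 1
produces the Frobenius-pushed Temkin chart `(m, A₀)`, the sorry-free in-tree lemma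
`exists_finset_generators_mem` produces finitely many field generators of `K/k` inside `O`
(invert those outside `O`), and stub 2 climbs the tower `k(A₀) ⊆ K` with `hT` and absorbs `R`.
[cite: Temkin2013, Rem. 1.3.5 (i)–(ii)] -/
theorem TorsorToLurelPerfect_of :
    Sig.stub_perfectFrobeniusChart → Sig.stub_perfectTowerAbsorb →
      Theses.FoliationDescent.TorsorToLurelPerfect := by
  intro h₁ h₂ p hp hT k K _ _ _ _ _ hfg O hO R hRfg hRO
  obtain ⟨m, A₀, h₀, hA₀fg, hRpow, hKpow, hreg₀⟩ := h₁ p hp k K hfg O hO R hRfg hRO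
  obtain ⟨G, hGO, hGtop⟩ := Theorems.exists_finset_generators_mem k K hfg O
  exact h₂ p hp hT k K O R hRfg hRO G hGO hGtop m A₀ h₀ hA₀fg hreg₀ hRpow (fun g _ => hKpow g)

/-- **The same composition concluding the item's PRIMARY decl** (route ShadowGame; the constant
`ledger skeleton check` resolves stmt-16162 to) — identical term, the two decls being
definitionally equal. [cite: Temkin2013, Rem. 1.3.5 (i)–(ii)] -/
theorem TorsorToLurelPerfect_of_shadowGame :
    Sig.stub_perfectFrobeniusChart → Sig.stub_perfectTowerAbsorb →
      Theses.ShadowGame.TorsorToLurelPerfect :=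
  fun h₁ h₂ => (torsorToLurelPerfect_foliationDescent_iff_shadowGame).mp (TorsorToLurelPerfect_of h₁ h₂)

/-- **The crux `TorsorToLurelPerfect` (primary decl, route ShadowGame), assembled from the two
registered stubs** — the skeleton theorem in its final shape: `TorsorToLurelPerfect_of_shadowGame`
with the `stub_*` plugged in; the only `sorry`s in its closure are the two stubs, none of its own. -/
theorem TorsorToLurelPerfect_proof : Theses.ShadowGame.TorsorToLurelPerfect :=
  TorsorToLurelPerfect_of_shadowGame stub_perfectFrobeniusChart stub_perfectTowerAbsorb

/-- **The crux `TorsorToLurelPerfect` (payload route FoliationDescent), assembled from the two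
registered stubs** (`TorsorToLurelPerfect_of` with the `stub_*` plugged in). -/
theorem TorsorToLurelPerfect_proof_foliationDescent : Theses.FoliationDescent.TorsorToLurelPerfect :=
  TorsorToLurelPerfect_of stub_perfectFrobeniusChart stub_perfectTowerAbsorb

end Summit.ResolutionOfSingularities.ResolutionOfSingularities.Cruxes.TorsorToLurelPerfect.Lines.Birth

end
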